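import Mathlib.LinearAlgebra.Lagrange
import Mathlib.FieldTheory.Finite.Basic
import Mathlib.Data.Fintype.CardEmbedding
import Mathlib.Algebra.Polynomial.Degree.Support
import Literature.Computability.Complexity.RobustSunflowerBound
import Literature.Combinatorics.SetFamily.BiasedMeasure
import HarnessLib

/-!
# The positive test distribution of the Harnik–Raz function (Cavalar–Kumar–Rossman, §2.3)

Counting lemmas about the sets `S_P = {P(1), …, P(k)} ⊆ 𝔽_n` of values of a uniformly random
polynomial `P ∈ 𝔽_n[x]` of degree `≤ c - 1` (`n` prime), i.e. of `toPoly v` for a uniformly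
random coefficient vector `v : Fin c → 𝔽_n` — the positive test distribution `𝐘 = x_{S_P}` of
Cavalar–Kumar–Rossman (Algorithmica 84 (2022), Def. 2.2) for the Harnik–Raz function
`harnikRazFn n c k` of `RobustSunflowerBound.lean`. Everything is stated in counting form
(numbers of coefficient vectors), denominators cleared.

* `toPoly v`, `hrSet k v = S_{toPoly v}`; `exists_toPoly_eq` (every `P` with `deg P < c` is a
  `toPoly v`); `harnikRazFn_hrSet` / `exists_hrSet_of_harnikRazFn` (the function in terms of
  `hrSet`, inputs `x_U` written `finsetEquivFun U`);
* `card_filter_eval_eq_mul` — **`c`-wise independence** (Alon–Babai–Itai; CKR §2.2): for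
  `ℓ ≤ c` distinct nodes and any targets, exactly `n^{c-ℓ}` coefficient vectors interpolate
  (Lagrange interpolation + all fibres of an additive surjection have equal size);
* `card_filter_subset_hrSet_mul_le` — **CKR Lemma 2.5**: `Pr[A ⊆ S_P] ≤ (k/n)^{|A|}` for
  `|A| ≤ c`, as `#{v : A ⊆ S_v} · n^{|A|} ≤ k^{|A|} · n^c`;
* `le_card_image_add_coll`, `card_filter_hrSet_small_mul_le` — **CKR Lemma 2.3** (= Harnik–Raz,
  Claim 4.1): `Pr[|S_P| < k/2] ≤ (k-1)/n`, as `#{v : 2 |S_v| < k} · n ≤ (k-1) · n^c`, via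
  "`k ≤ #image + #coinciding pairs`" and Markov on the expected number `(k choose 2)/n` of
  coinciding pairs (pairwise independence, `c ≥ 2`).

## References

* B. P. Cavalar, M. Kumar, B. Rossman, *Monotone circuit lower bounds from robust sunflowers*,
  Algorithmica 84 (2022), §2.2–2.3, Def. 2.2, Lemmas 2.3, 2.5 [CavalarKumarRossman2022].
* D. Harnik, R. Raz, *Higher lower bounds on monotone size*, STOC 2000, Claim 4.1.
-/

namespace Literature.Computability.Complexity.CKR

open Finset Polynomial Literature.Combinatorics.SetFamily

variable {n : ℕ} {c k : ℕ}

/-! ### Polynomials of degree `< c` as coefficient vectors -/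

/-- The polynomial `∑_{i < c} v_i x^i ∈ 𝔽_n[x]` with coefficient vector `v` (CKR §2.2: "a
polynomial of degree at most `c - 1` chosen uniformly at random"). [cite: CavalarKumarRossman2022, §2.2] -/
noncomputable def toPoly (v : Fin c → ZMod n) : Polynomial (ZMod n) :=
  ∑ i : Fin c, C (v i) * X ^ (i : ℕ)

/-- Evaluation of `toPoly v`. [folklore] -/
theorem eval_toPoly (v : Fin c → ZMod n) (a : ZMod n) :
    (toPoly v).eval a = ∑ i : Fin c, v i * a ^ (i : ℕ) := by
  simp [toPoly, eval_finsetSum]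

/-- `toPoly` is additive. [folklore] -/
theorem toPoly_add (v w : Fin c → ZMod n) : toPoly (v + w) = toPoly v + toPoly w := by
  simp only [toPoly, Pi.add_apply, C_add, add_mul]
  exact sum_add_distrib

/-- `toPoly 0 = 0`. [folklore] -/
@[simp] theorem toPoly_zero : toPoly (0 : Fin c → ZMod n) = 0 := by
  simp [toPoly]

/-- `toPoly v` has degree `≤ c - 1`. [folklore] -/
theorem natDegree_toPoly_lt (hc : 1 ≤ c) (v : Fin c → ZMod n) : (toPoly v).natDegree < c := by
  have h : (toPoly v).natDegree ≤ c - 1 := by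
    unfold toPoly
    refine natDegree_sum_le_of_forall_le _ _ fun i _ => ?_
    exact (natDegree_C_mul_X_pow_le (v i) (i : ℕ)).trans (by omega)
  omega

/-- Every polynomial of degree `< c` is `toPoly` of its coefficient vector. [folklore] -/
theorem exists_toPoly_eq {P : Polynomial (ZMod n)} (hP : P.natDegree < c) :
    ∃ v : Fin c → ZMod n, toPoly v = P := by
  refine ⟨fun i => P.coeff i, ?_⟩
  unfold toPoly
  rw [Fin.sum_univ_eq_sum_range (fun i => C (P.coeff i) * X ^ i) c]
  exact (as_sum_range_C_mul_X_pow' P hP).symm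

/-- The number of coefficient vectors is `n^c`. [folklore] -/
theorem card_coeffVec [NeZero n] : Fintype.card (Fin c → ZMod n) = n ^ c := by
  rw [Fintype.card_fun, ZMod.card, Fintype.card_fin]

/-! ### The Harnik–Raz sets of coefficient vectors -/

/-- `S_v = {P_v(1), …, P_v(k)}` for the polynomial with coefficient vector `v` (CKR §2.2).
[cite: CavalarKumarRossman2022, §2.2] -/
noncomputable def hrSet (k : ℕ) (v : Fin c → ZMod n) : Finset (ZMod n) := harnikRazSet n k (toPoly v)

/-- Membership in `S_v`. [cite: CavalarKumarRossman2022, §2.2] -/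
theorem mem_hrSet {v : Fin c → ZMod n} {a : ZMod n} :
    a ∈ hrSet k v ↔ ∃ i < k, (toPoly v).eval ((i + 1 : ℕ) : ZMod n) = a := by
  simp [hrSet, harnikRazSet]

/-- `S_v` is the image of the nodes (definitional). [cite: CavalarKumarRossman2022, §2.2] -/
theorem hrSet_eq_image (v : Fin c → ZMod n) :
    hrSet k v = (range k).image fun i => (toPoly v).eval ((i + 1 : ℕ) : ZMod n) := rfl

/-- `|S_v| ≤ k`. [cite: CavalarKumarRossman2022, §2.2] -/
theorem card_hrSet_le (v : Fin c → ZMod n) : #(hrSet k v) ≤ k :=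
  card_image_le.trans (card_range k).le

/-- **The Harnik–Raz function accepts its large test sets** (CKR, proof of Lemma 2.3:
`f_HR(𝐘) = 0` iff `|S_P| < k/2`): if `|S_v| ≥ k/2` then `f_HR(x_{S_v}) = 1`, witnessed by
`P = toPoly v` itself. [cite: CavalarKumarRossman2022, Lemma 2.3] -/
theorem harnikRazFn_hrSet [NeZero n] (hc : 1 ≤ c) {v : Fin c → ZMod n} (hv : k ≤ 2 * #(hrSet k v)) :
    harnikRazFn n c k (finsetEquivFun (hrSet k v)) = true := by
  rw [harnikRazFn_eq_true_iff]
  refine ⟨toPoly v, natDegree_toPoly_lt hc v, hv, fun j hj => ?_⟩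
  exact decide_eq_true hj

/-- Conversely, if `f_HR(x_U) = 1` then `U` contains a large `S_v` (every polynomial of degree
`≤ c - 1` is a `toPoly v`). [cite: CavalarKumarRossman2022, Lemma 2.4] -/
theorem exists_hrSet_of_harnikRazFn [NeZero n] {U : Finset (ZMod n)}
    (h : harnikRazFn n c k (finsetEquivFun U) = true) :
    ∃ v : Fin c → ZMod n, k ≤ 2 * #(hrSet k v) ∧ hrSet k v ⊆ U := by
  obtain ⟨P, hP, hk, hU⟩ := harnikRazFn_eq_true_iff.1 h
  obtain ⟨v, hv⟩ := exists_toPoly_eq (P := P) (c := c) (by omega)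
  refine ⟨v, ?_, fun j hj => ?_⟩
  · rw [hrSet, hv]; exact hk
  · rw [hrSet, hv] at hj
    exact of_decide_eq_true (hU j hj)

/-- The nodes `1, …, k` are distinct in `𝔽_n` for `k < n`. [folklore] -/
theorem natCast_succ_injective (hkn : k < n) {i j : ℕ} (hi : i < k) (hj : j < k)
    (h : ((i + 1 : ℕ) : ZMod n) = ((j + 1 : ℕ) : ZMod n)) : i = j := by
  rw [ZMod.natCast_eq_natCast_iff', Nat.mod_eq_of_lt (by omega), Nat.mod_eq_of_lt (by omega)] at h
  omega

/-- The number of *coinciding pairs* `i < j < k` with `f i = f j` (CKR, proof of Lemma 2.3),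
summed by the larger index. [cite: CavalarKumarRossman2022, Lemma 2.3] -/
def coll {X : Type*} [DecidableEq X] (f : ℕ → X) (k : ℕ) : ℕ :=
  ∑ j ∈ range k, #((range j).filter fun i => f i = f j)

/-- **`k ≤ #image + #coinciding pairs`** (CKR, proof of Lemma 2.3: "`|S_P| < k/2` occurs only
if there are more than `k/2` coinciding pairs"). [cite: CavalarKumarRossman2022, Lemma 2.3] -/
theorem le_card_image_add_coll {X : Type*} [DecidableEq X] (f : ℕ → X) :
    ∀ k : ℕ, k ≤ #((range k).image f) + coll f k
  | 0 => Nat.zero_le _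
  | k + 1 => by
    have ih := le_card_image_add_coll f k
    have hcoll : coll f (k + 1) = coll f k + #((range k).filter fun i => f i = f k) := by
      unfold coll
      rw [sum_range_succ]
    rw [hcoll, range_add_one, image_insert]
    by_cases hk : f k ∈ (range k).image f
    · rw [insert_eq_of_mem hk]
      obtain ⟨i, hi, hik⟩ := mem_image.1 hk
      have : 1 ≤ #((range k).filter fun i => f i = f k) :=
        card_pos.2 ⟨i, mem_filter.2 ⟨hi, hik⟩⟩
      omega
    · rw [card_insert_of_notMem hk]
      omega

/-! ### `c`-wise independence: counting interpolating coefficient vectors -/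

variable [Fact n.Prime]

/-- **`c`-wise independence of the values of a random polynomial of degree `< c`**
(Alon–Babai–Itai 1986; CKR §2.2 and proof of Lemma 2.5): for at most `c` distinct nodes `a_j` and
arbitrary targets `b_j`, the number of `v` with `(toPoly v)(a_j) = b_j` for all `j` is exactly
`n^{c - #nodes}` (stated as `# · n^{#nodes} = n^c`). Proof: `v ↦ (toPoly v (a_j))_j` is additive and
onto (Lagrange interpolation), so all its fibres are translates of the kernel.
[cite: CavalarKumarRossman2022, Lemma 2.5] -/
theorem card_filter_eval_eq_mul {ι : Type*} [Fintype ι] [DecidableEq ι] (a : ι → ZMod n)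
    (ha : Function.Injective a) (hι : Fintype.card ι ≤ c) (b : ι → ZMod n) :
    #(univ.filter fun v : Fin c → ZMod n => ∀ j, (toPoly v).eval (a j) = b j) * n ^ Fintype.card ι
      = n ^ c := by
  set Φ : (Fin c → ZMod n) → (ι → ZMod n) := fun v j => (toPoly v).eval (a j) with hΦdef
  have hΦ : ∀ v w, Φ (v + w) = Φ v + Φ w := by
    intro v w
    funext j
    simp [hΦdef, toPoly_add]
  have hfilter : ∀ b' : ι → ZMod n, (univ.filter fun v : Fin c → ZMod n => ∀ j, (toPoly v).eval (a j) = b' j)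
      = univ.filter fun v => Φ v = b' := by
    intro b'
    ext v
    simp only [mem_filter, mem_univ, true_and, hΦdef]
    exact funext_iff.symm
  -- surjectivity via Lagrange interpolation
  have hinj : Set.InjOn a ↑(univ : Finset ι) := ha.injOn
  have hsurj : ∀ b' : ι → ZMod n, ∃ v, Φ v = b' := by
    intro b'
    set P := Lagrange.interpolate univ a b' with hP
    have hdeg : P.degree < (Fintype.card ι : ℕ) := by
      have := Lagrange.degree_interpolate_lt b' hinj
      rwa [card_univ] at this
    have hev : ∀ j, P.eval (a j) = b' j := fun j => Lagrange.eval_interpolate_at_node b' hinj (mem_univ j)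
    by_cases hP0 : P = 0
    · refine ⟨0, funext fun j => ?_⟩
      have := hev j
      rw [hP0, eval_zero] at this
      simp [hΦdef, ← this]
    · have hnat : P.natDegree < c :=
        ((natDegree_lt_iff_degree_lt hP0).2 hdeg).trans_le hι
      obtain ⟨v, hv⟩ := exists_toPoly_eq hnat
      exact ⟨v, funext fun j => by simp [hΦdef, hv, hev]⟩
  -- all fibres have the cardinality of the kernel
  have hfib : ∀ b' : ι → ZMod n,
      #(univ.filter fun v => Φ v = b') = #(univ.filter fun v => Φ v = 0) := by
    intro b'
    obtain ⟨v₀, hv₀⟩ := hsurj b'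
    have hset : (univ.filter fun v => Φ v = b') = (univ.filter fun v => Φ v = 0).image fun w => w + v₀ := by
      ext v
      simp only [mem_filter, mem_univ, true_and, mem_image]
      constructor
      · intro hv
        refine ⟨v - v₀, ?_, sub_add_cancel v v₀⟩
        have h := hΦ (v - v₀) v₀
        rw [sub_add_cancel, hv, hv₀] at h
        exact (add_eq_right.1 h.symm)
      · rintro ⟨w, hw, rfl⟩
        rw [hΦ, hw, hv₀, zero_add]
    rw [hset, card_image_of_injective _ (add_left_injective v₀)]
  -- sum over the fibres
  have hsum := card_eq_sum_card_fiberwise (f := Φ) (s := (univ : Finset (Fin c → ZMod n)))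
    (t := (univ : Finset (ι → ZMod n))) fun v _ => mem_univ _
  rw [card_univ, card_coeffVec] at hsum
  simp_rw [hfib] at hsum
  rw [sum_const, card_univ, Fintype.card_fun, ZMod.card, smul_eq_mul] at hsum
  rw [hfilter, hfib b, hsum, mul_comm]

/-- **CKR Lemma 2.5** (`Pr[x_A ≤ 𝐘] ≤ (k/n)^{|A|}` for `|A| ≤ c`), in counting form:
`#{v : A ⊆ S_v} · n^{|A|} ≤ k^{|A|} · n^c`. Proof: `A ⊆ S_v` gives an injection `e : A ↪ [k]` with
`P_v(e(a)) = a`; for each of the `≤ k^{|A|}` injections exactly `n^{c-|A|}` vectors `v` qualify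
by `c`-wise independence. [cite: CavalarKumarRossman2022, Lemma 2.5] -/
theorem card_filter_subset_hrSet_mul_le (hkn : k < n) (A : Finset (ZMod n)) (hA : #A ≤ c) :
    #(univ.filter fun v : Fin c → ZMod n => A ⊆ hrSet k v) * n ^ #A ≤ k ^ #A * n ^ c := by
  classical
  -- the events indexed by injections `A ↪ Fin k`
  set F : (A ↪ Fin k) → Finset (Fin c → ZMod n) := fun e =>
    univ.filter fun v => ∀ x : A, (toPoly v).eval (((e x : ℕ) + 1 : ℕ) : ZMod n) = (x : ZMod n) with hF
  have hcover : (univ.filter fun v : Fin c → ZMod n => A ⊆ hrSet k v) ⊆ univ.biUnion F := by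
    intro v hv
    have hAv := (mem_filter.1 hv).2
    have hex : ∀ x : A, ∃ i : Fin k, (toPoly v).eval (((i : ℕ) + 1 : ℕ) : ZMod n) = (x : ZMod n) := by
      intro x
      obtain ⟨i, hi, hix⟩ := mem_hrSet.1 (hAv x.2)
      exact ⟨⟨i, hi⟩, hix⟩
    choose g hg using hex
    have hginj : Function.Injective g := by
      intro x y hxy
      apply Subtype.ext
      rw [← hg x, ← hg y, hxy]
    refine mem_biUnion.2 ⟨⟨g, hginj⟩, mem_univ _, mem_filter.2 ⟨mem_univ _, fun x => ?_⟩⟩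
    exact hg x
  have hF_card : ∀ e : A ↪ Fin k, #(F e) * n ^ #A = n ^ c := by
    intro e
    have hnodes : Function.Injective fun x : A => (((e x : ℕ) + 1 : ℕ) : ZMod n) := by
      intro x y hxy
      exact e.injective (Fin.ext (natCast_succ_injective hkn (e x).2 (e y).2 hxy))
    have h := card_filter_eval_eq_mul (c := c) _ hnodes (by rw [Fintype.card_coe]; exact hA)
      fun x : A => (x : ZMod n)
    rwa [Fintype.card_coe] at h
  have hemb : Fintype.card (A ↪ Fin k) ≤ k ^ #A := by
    rw [Fintype.card_embedding_eq, Fintype.card_coe, Fintype.card_fin]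
    exact Nat.descFactorial_le_pow k #A
  calc #(univ.filter fun v : Fin c → ZMod n => A ⊆ hrSet k v) * n ^ #A
      ≤ #(univ.biUnion F) * n ^ #A := Nat.mul_le_mul_right _ (card_le_card hcover)
    _ ≤ (∑ e : A ↪ Fin k, #(F e)) * n ^ #A := Nat.mul_le_mul_right _ card_biUnion_le
    _ = ∑ e : A ↪ Fin k, #(F e) * n ^ #A := sum_mul _ _ _
    _ = Fintype.card (A ↪ Fin k) * n ^ c := by
        rw [sum_congr rfl fun e _ => hF_card e, sum_const, card_univ, smul_eq_mul]
    _ ≤ k ^ #A * n ^ c := Nat.mul_le_mul_right _ hemb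

/-! ### Lemma 2.3: the test sets are large -/

/-- **Pairwise independence**: for distinct nodes `i < j < k < n` (and `c ≥ 2`), exactly a `1/n`
fraction of the coefficient vectors have `P_v(i+1) = P_v(j+1)`:
`#{v : P_v(i+1) = P_v(j+1)} · n = n^c`. [cite: CavalarKumarRossman2022, Lemma 2.3] -/
theorem card_filter_eval_eq_eval_mul (hc : 2 ≤ c) (hkn : k < n) {i j : ℕ} (hij : i < j) (hj : j < k) :
    #(univ.filter fun v : Fin c → ZMod n =>
        (toPoly v).eval ((i + 1 : ℕ) : ZMod n) = (toPoly v).eval ((j + 1 : ℕ) : ZMod n)) * n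
      = n ^ c := by
  -- nodes as an injective map from `Fin 2`
  set a : Fin 2 → ZMod n := ![((i + 1 : ℕ) : ZMod n), ((j + 1 : ℕ) : ZMod n)] with ha
  have hane : ((i + 1 : ℕ) : ZMod n) ≠ ((j + 1 : ℕ) : ZMod n) := fun h =>
    absurd (natCast_succ_injective hkn (hij.trans hj) hj h) hij.ne
  have hainj : Function.Injective a := by
    intro x y hxy
    fin_cases x <;> fin_cases y
    · rfl
    · exact absurd hxy hane
    · exact absurd hxy.symm hane
    · rfl
  -- split the event by the common value `t`
  have hsplit : #(univ.filter fun v : Fin c → ZMod n =>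
      (toPoly v).eval ((i + 1 : ℕ) : ZMod n) = (toPoly v).eval ((j + 1 : ℕ) : ZMod n))
      = ∑ t : ZMod n, #(univ.filter fun v : Fin c → ZMod n => ∀ x, (toPoly v).eval (a x) = t) := by
    rw [card_eq_sum_card_fiberwise (f := fun v : Fin c → ZMod n => (toPoly v).eval ((i + 1 : ℕ) : ZMod n))
      (t := univ) fun v _ => mem_univ _]
    refine sum_congr rfl fun t _ => ?_
    congr 1
    ext v
    simp only [mem_filter, mem_univ, true_and, Fin.forall_fin_two, ha, Matrix.cons_val_zero,
      Matrix.cons_val_one]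
    constructor
    · rintro ⟨h1, h2⟩; exact ⟨h2, h1 ▸ h2⟩
    · rintro ⟨h1, h2⟩; exact ⟨h1.trans h2.symm, h1⟩
  rw [hsplit, sum_mul]
  have hn : 0 < n := (Fact.out : n.Prime).pos
  have hc1 : 1 ≤ c := by omega
  have hterm : ∀ t : ZMod n,
      #(univ.filter fun v : Fin c → ZMod n => ∀ x, (toPoly v).eval (a x) = t) * n = n ^ (c - 1) := by
    intro t
    have h := card_filter_eval_eq_mul (c := c) a hainj (by rw [Fintype.card_fin]; exact hc) fun _ => t
    rw [Fintype.card_fin] at h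
    have h' : #(univ.filter fun v : Fin c → ZMod n => ∀ x, (toPoly v).eval (a x) = t) * n * n
        = n ^ (c - 1) * n := by
      have e1 : #(univ.filter fun v : Fin c → ZMod n => ∀ x, (toPoly v).eval (a x) = t) * n * n
          = #(univ.filter fun v : Fin c → ZMod n => ∀ x, (toPoly v).eval (a x) = t) * n ^ 2 := by
        ring
      rw [e1, ← pow_succ, Nat.sub_add_cancel hc1]
      convert h using 3
      ext v
      simp only [mem_filter]
    exact Nat.eq_of_mul_eq_mul_right hn h'
  simp_rw [hterm]
  rw [sum_const, card_univ, ZMod.card, smul_eq_mul, mul_comm, ← pow_succ, Nat.sub_add_cancel hc1]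

/-- The expected number of coinciding pairs is `(k choose 2)/n` (CKR, proof of Lemma 2.3), in
counting form: `(∑_v coll_v) · n · 2 = k (k-1) · n^c`. [cite: CavalarKumarRossman2022, Lemma 2.3] -/
theorem sum_coll_mul (hc : 2 ≤ c) (hkn : k < n) :
    (∑ v : Fin c → ZMod n, coll (fun i => (toPoly v).eval ((i + 1 : ℕ) : ZMod n)) k) * n * 2
      = k * (k - 1) * n ^ c := by
  unfold coll
  rw [sum_comm, sum_mul, sum_mul]
  have hinner : ∀ j ∈ range k,
      (∑ v : Fin c → ZMod n, #((range j).filter fun i =>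
          (toPoly v).eval ((i + 1 : ℕ) : ZMod n) = (toPoly v).eval ((j + 1 : ℕ) : ZMod n))) * n * 2
        = j * n ^ c * 2 := by
    intro j hj
    rw [mem_range] at hj
    have hswap : ∑ v : Fin c → ZMod n, #((range j).filter fun i =>
          (toPoly v).eval ((i + 1 : ℕ) : ZMod n) = (toPoly v).eval ((j + 1 : ℕ) : ZMod n))
        = ∑ i ∈ range j, #(univ.filter fun v : Fin c → ZMod n =>
            (toPoly v).eval ((i + 1 : ℕ) : ZMod n) = (toPoly v).eval ((j + 1 : ℕ) : ZMod n)) := by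
      simp only [card_eq_sum_ones, sum_filter]
      exact sum_comm
    rw [hswap, sum_mul, sum_congr rfl fun i hi => card_filter_eval_eq_eval_mul hc hkn (mem_range.1 hi) hj,
      sum_const, card_range, smul_eq_mul]
  rw [sum_congr rfl hinner, ← sum_mul, ← sum_mul]
  have h2 := sum_range_id_mul_two k
  calc (∑ i ∈ range k, i) * n ^ c * 2 = (∑ i ∈ range k, i) * 2 * n ^ c := by ring
    _ = k * (k - 1) * n ^ c := by rw [h2]

/-- **CKR Lemma 2.3** (Harnik–Raz, Claim 4.1: `Pr[f_HR(𝐘) = 1] ≥ 1 - (k-1)/n`), in counting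
form: the number of coefficient vectors with `|S_v| < k/2` is at most `(k-1) n^{c-1}`, i.e.
`#{v : 2 |S_v| < k} · n ≤ (k-1) · n^c` (for `c ≥ 2`, `k < n`; Markov's inequality on the number of
coinciding pairs). [cite: CavalarKumarRossman2022, Lemma 2.3] -/
theorem card_filter_hrSet_small_mul_le (hc : 2 ≤ c) (hkn : k < n) :
    #(univ.filter fun v : Fin c → ZMod n => 2 * #(hrSet k v) < k) * n ≤ (k - 1) * n ^ c := by
  set Bad := univ.filter fun v : Fin c → ZMod n => 2 * #(hrSet k v) < k with hBad
  set X : (Fin c → ZMod n) → ℕ := fun v => coll (fun i => (toPoly v).eval ((i + 1 : ℕ) : ZMod n)) k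
    with hX
  -- on `Bad`, `k + 1 ≤ 2 X`
  have hpt : ∀ v ∈ Bad, k + 1 ≤ 2 * X v := by
    intro v hv
    have hv' := (mem_filter.1 hv).2
    have h := le_card_image_add_coll (fun i => (toPoly v).eval ((i + 1 : ℕ) : ZMod n)) k
    rw [← hrSet_eq_image] at h
    simp only [hX]
    omega
  -- Markov
  have hmarkov : #Bad * (k + 1) ≤ 2 * ∑ v : Fin c → ZMod n, X v :=
    calc #Bad * (k + 1) = ∑ v ∈ Bad, (k + 1) := by rw [sum_const, smul_eq_mul]
      _ ≤ ∑ v ∈ Bad, 2 * X v := sum_le_sum hpt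
      _ ≤ ∑ v : Fin c → ZMod n, 2 * X v :=
          sum_le_sum_of_subset_of_nonneg (filter_subset _ _) fun v _ _ => Nat.zero_le _
      _ = 2 * ∑ v : Fin c → ZMod n, X v := (mul_sum _ _ _).symm
  have hsum : (∑ v : Fin c → ZMod n, X v) * n * 2 = k * (k - 1) * n ^ c := sum_coll_mul (c := c) hc hkn
  -- `#Bad (k+1) n ≤ k (k-1) n^c ≤ (k+1)(k-1) n^c`
  have h1 : #Bad * n * (k + 1) ≤ (k - 1) * n ^ c * (k + 1) := by
    calc #Bad * n * (k + 1) = #Bad * (k + 1) * n := by ring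
      _ ≤ 2 * (∑ v : Fin c → ZMod n, X v) * n := Nat.mul_le_mul_right _ hmarkov
      _ = k * (k - 1) * n ^ c := by rw [← hsum]; ring
      _ ≤ (k + 1) * (k - 1) * n ^ c := Nat.mul_le_mul_right _ (Nat.mul_le_mul_right _ (by omega))
      _ = (k - 1) * n ^ c * (k + 1) := by ring
  exact Nat.le_of_mul_le_mul_right h1 (Nat.succ_pos k)

end Literature.Computability.Complexity.CKR
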